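import Summits.CriticalPhenomena.PercolationContinuityZ3.Theorems.PercNearOneGluingNoHeavyLowerTailSunflowerMultiPetalKempeMarkedTICells
import HarnessLib
import HarnessLib.Audit

/-!
# `NoHeavyLowerTail` (crux stmt-CriticalPhenomena-4575), marked multigraphs, THEOREM TI2: the PAYER CELLS OF THE MARKED GRAPH `K⁺` in the weighted
# charging (outer degree `|S| ≥ 2`)

Support file (seat `prim-l12-p2` gen 52; `--supports stmt-CriticalPhenomena-4575`; continuation of `…KempeMarkedTICells` and of g47's `…KempeMarkedCharging`
(p596133)).  No `sorry`; nothing is asserted about the crux.  Memo: run/shared/lean/prim/prim-l12/prim-l12-p2/PROOF-TI2-MARKED-MULTIGRAPHS-g51.md §3 (d)–(e).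

In the weighted cell sum `Σ resW` (p? `…TICells`) a colouring whose special vertex `s` has the weight colour `c` is a cell of `K⁺ = K + one mark at the
`c`-coloured terminal` (weight `1`), every other colouring a cell of `K` (weight `2`, deficits `−2`).  g47's charging map `ψ` sometimes moves a `K`-deficit to a
`K⁺`-cell, whose value must then be `≥ 2` on its own.  This file supplies exactly these values, re-deriving the type/profile bookkeeping of p596133 with the extra
mark:
* `mul_addMark`, `mark_addMark_of_ne`, `ctypeM_isolate_addMark` — `K⁺` has the same edges, and its types are `K`'s shifted by `e_c`;
* `resCell_addMark_fst_nonneg` — NO `K⁺ᵘ`-cell is a deficit (the mark at `u` kills g47's four families); `resCell_addMark_snd_neg` — a negative `K⁺ᵛ`-cell is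
  a D4 cell (the only family compatible with a `1`-member), of value `−1`, with its data in `K⁺ᵛ`-terms;
* `resCell_addMark_phiU_of_D1`/`_of_D2` (P1⁺, P2⁺ `= 2`), `resCell_addMark_partner_of_D5` (P5⁺ `= 2`, also for `|S| = 2` thanks to the mark),
  `resCell_addMark_sibling_of_D4` (P4⁺ in `K⁺ᵛ`, `= 2`).
-/

namespace Summit.CriticalPhenomena.PercolationContinuityZ3.Theorems.SunflowerPartition.Kempe

open Finset

/-! ## Finite payer tables with the extra terminal mark -/

/-- P1⁺: all-`0` cell of `K⁺ᵘ` at a type `(≥1,0,0)`: `kerTAbs (t⊕e₀) (2,0,0) − fC (t⊕e₀) = 2`. (finite check) [this work] -/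
theorem payer_allZero_mark : ∀ t : CType, t.2.1 = 0 → t.2.2 = 0 → t.1 ≠ 0 →
    kerTAbs (ctAdd t (xPart 0 (1, 1, 1))) (2, 0, 0) - fC (ctAdd t (xPart 0 (1, 1, 1))) = 2 := by decide
/-- P2⁺: `kerTAbs (t⊕e₀) (1,2,0) = 2` at a type `(≥1,0,0)`. (finite check) [this work] -/
theorem payer_allOne_mark : ∀ t : CType, t.2.1 = 0 → t.2.2 = 0 → t.1 ≠ 0 → kerTAbs (ctAdd t (xPart 0 (1, 1, 1))) (1, 2, 0) = 2 := by decide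
/-- P5⁺: `kerTAbs (t⊕e₀) (2,0,c) = 2` at a type `(≥1,0,0)`, any `c ≠ 0` (the mark saturates the first coordinate). (finite check) [this work] -/
theorem payer_allTwoButOne_mark : ∀ (t : CType) (c : Fin 3), t.2.1 = 0 → t.2.2 = 0 → t.1 ≠ 0 → c ≠ 0 →
    kerTAbs (ctAdd t (xPart 0 (1, 1, 1))) (2, 0, c) = 2 := by decide
/-- P4⁺ (weight at `v`): `kerTAbs (t⊕e₁) (2,1,0) = 2` at a type `(0,≥1,0)`. (finite check) [this work] -/
theorem payer_sibling_mark : ∀ t : CType, t.1 = 0 → t.2.2 = 0 → t.2.1 ≠ 0 → kerTAbs (ctAdd t (xPart 1 (1, 1, 1))) (2, 1, 0) = 2 := by decide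
/-- A type shifted by `e₀` has a nonzero first coordinate. (finite check) [this work] -/
theorem ctAdd_e0_fst_ne_zero : ∀ t : CType, (ctAdd t (xPart 0 (1, 1, 1))).1 ≠ 0 := by decide
/-- A type shifted by `e₁` has a nonzero second coordinate. (finite check) [this work] -/
theorem ctAdd_e1_snd_ne_zero : ∀ t : CType, (ctAdd t (xPart 1 (1, 1, 1))).2.1 ≠ 0 := by decide

namespace MGraph

variable {V : Type*} [Fintype V] [LinearOrder V] (K : MGraph V)

/-! ## `K⁺` has the same edges; its types are shifted -/

section AddMark

omit [Fintype V] in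
/-- Marks do not change multiplicities. [this work] -/
@[simp] theorem mul_addMark (w : V) (m : ℕ) (a b : V) : (K.addMark w m).mul a b = K.mul a b := by
  unfold addMark addAtU; simp

omit [Fintype V] in
/-- Marks at `w` do not change the marks elsewhere. [this work] -/
theorem mark_addMark_of_ne (w : V) (m : ℕ) {a : V} (ha : a ≠ w) : (K.addMark w m).mark a = K.mark a := by
  unfold addMark addAtU; simp [ha]

/-- Types of `K⁺.isolate y` are types of `K.isolate y` shifted by one at the colour of the marked vertex `w ≠ y`. [this work] -/
theorem ctypeM_isolate_addMark (w y : V) (hwy : w ≠ y) (ρ : V → Fin 3) :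
    ((K.addMark w 1).isolate y).ctypeM ρ = ctAdd ((K.isolate y).ctypeM ρ) (xPart (ρ w) (1, 1, 1)) := by
  rw [K.isolate_addMark w y hwy 1, (K.isolate y).ctypeM_addMark w 1 ρ, cap3_one_triple]

variable {K}
variable {u v y : V} {S : Finset V}

omit [Fintype V] in
/-- The outer-neighbour description transfers to `K⁺`. [this work] -/
theorem hS_addMark (hS : ∀ w, w ∈ S ↔ (w ≠ u ∧ w ≠ v ∧ w ≠ y ∧ K.mul y w ≠ 0)) (x : V) (m : ℕ) :
    ∀ w, w ∈ S ↔ (w ≠ u ∧ w ≠ v ∧ w ≠ y ∧ (K.addMark x m).mul y w ≠ 0) := fun w => by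
  rw [mul_addMark]; exact hS w

/-- **No `K⁺ᵘ`-cell is a deficit**: with the extra mark at `u`, every cell residual of `K⁺ᵘ = K.addMark u 1` is nonnegative (for `|S| ≥ 2`). [this work] -/
theorem resCell_addMark_fst_nonneg (hS : ∀ w, w ∈ S ↔ (w ≠ u ∧ w ≠ v ∧ w ≠ y ∧ K.mul y w ≠ 0)) (huv : u ≠ v) (hyu : y ≠ u) (hyv : y ≠ v)
    (hmy : K.mark y = 0) (hyu' : K.mul y u ≠ 0) (htwo : 2 ≤ S.card) (ρ : V → Fin 3) (hu : ρ u = 0) (hv : ρ v = 1) :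
    0 ≤ (K.addMark u 1).resCell y S ρ := by
  by_contra hneg
  push Not at hneg
  have hmy' : (K.addMark u 1).mark y = 0 := by rw [mark_addMark_of_ne _ u 1 hyu, hmy]
  have hyu'' : (K.addMark u 1).mul y u ≠ 0 := by rw [mul_addMark]; exact hyu'
  have h1 : (((K.addMark u 1).isolate y).ctypeM ρ).1 ≠ 0 := by
    rw [K.ctypeM_isolate_addMark u y hyu.symm ρ, hu]; exact ctAdd_e0_fst_ne_zero _
  rcases resCell_neg_cases (hS_addMark hS u 1) huv hyu hyv hmy' hyu'' htwo ρ hu hv hneg with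
    ⟨-, -, -, ht⟩ | ⟨-, -, ht⟩ | ⟨_, -, -, -, -, -, ht⟩ | ⟨_, -, -, -, -, -, ht⟩
  all_goals (rw [ht] at h1; exact h1 rfl)

/-- **The deficits of `K⁺ᵛ`**: a negative cell of `K⁺ᵛ = K.addMark v 1` is a D4 cell (`S ≡ 0` but one simply-joined `s₀ ↦ 2`, `mul y v = 0`, type `(0,1,0)` in
`K⁺ᵛ.isolate y`), of value `−1`. [this work] -/
theorem resCell_addMark_snd_neg (hS : ∀ w, w ∈ S ↔ (w ≠ u ∧ w ≠ v ∧ w ≠ y ∧ K.mul y w ≠ 0)) (huv : u ≠ v) (hyu : y ≠ u) (hyv : y ≠ v)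
    (hmy : K.mark y = 0) (hyu' : K.mul y u ≠ 0) (htwo : 2 ≤ S.card) (ρ : V → Fin 3) (hu : ρ u = 0) (hv : ρ v = 1)
    (hneg : (K.addMark v 1).resCell y S ρ < 0) :
    (∃ s₀ ∈ S, ρ s₀ = 2 ∧ (K.addMark v 1).mul y s₀ = 1 ∧ (∀ s ∈ S, s ≠ s₀ → ρ s = 0) ∧ (K.addMark v 1).mul y v = 0 ∧
      ((K.addMark v 1).isolate y).ctypeM ρ = (0, 1, 0)) ∧ (K.addMark v 1).resCell y S ρ = -1 := by
  have hmy' : (K.addMark v 1).mark y = 0 := by rw [mark_addMark_of_ne _ v 1 hyv, hmy]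
  have hyu'' : (K.addMark v 1).mul y u ≠ 0 := by rw [mul_addMark]; exact hyu'
  have h1 : (((K.addMark v 1).isolate y).ctypeM ρ).2.1 ≠ 0 := by
    rw [K.ctypeM_isolate_addMark v y hyv.symm ρ, hv]; exact ctAdd_e1_snd_ne_zero _
  refine ⟨?_, resCell_eq_neg_one_of_neg (hS_addMark hS v 1) huv hyu hyv hmy' hyu'' htwo ρ hu hv hneg⟩
  rcases resCell_neg_cases (hS_addMark hS v 1) huv hyu hyv hmy' hyu'' htwo ρ hu hv hneg with
    ⟨-, -, -, ht⟩ | ⟨-, -, ht⟩ | h | ⟨_, -, -, -, -, -, ht⟩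
  · rw [ht] at h1; exact absurd rfl h1
  · rw [ht] at h1; exact absurd rfl h1
  · exact h
  · rw [ht] at h1; exact absurd rfl h1

end AddMark

/-! ## Payer values in `K⁺` -/

section Payers

variable {K}
variable {u v y : V} {S : Finset V}

/-- **P1⁺** (weight at `u`): for a D1 cell of `K`, the all-`0` partner cell `Φ_u ρ` has `K⁺ᵘ`-residual `2`. [this work] -/
theorem resCell_addMark_phiU_of_D1 (hS : ∀ w, w ∈ S ↔ (w ≠ u ∧ w ≠ v ∧ w ≠ y ∧ K.mul y w ≠ 0)) (huv : u ≠ v) (hyu : y ≠ u) (hyv : y ≠ v)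
    (hmy : K.mark y = 0) (hyu' : K.mul y u ≠ 0) (hne : S.Nonempty) (ρ : V → Fin 3) (hu : ρ u = 0) (hv : ρ v = 1)
    (hall : ∀ s ∈ S, ρ s = 2) (hyv' : K.mul y v = 0) (ht : (K.isolate y).ctypeM ρ = (0, 0, 1)) :
    (K.addMark u 1).resCell y S (phiU u ρ) = 2 := by
  have hu' : phiU u ρ u = 0 := by rw [phiU_self, hu]
  have hv' : phiU u ρ v = 1 := by rw [phiU_of_ne u ρ huv.symm, hv]; decide
  have huS : u ∉ S := fun h => ((hS u).1 h).1 rfl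
  have hall' : ∀ s ∈ S, phiU u ρ s = 0 := fun s hs => by
    rw [phiU_of_ne u ρ (fun h => huS (h ▸ hs)), hall s hs]; decide
  obtain ⟨tb, tc, ta⟩ := ctypeM_isolate_phiU_of_001 ρ hu ht
  have hprof := profM_allZero hS huv hyu hyv hmy hyu' hne (phiU u ρ) hu' hv' hall'
  have hmid : (K.profM y (phiU u ρ)).2.1 = 0 := by
    unfold profM
    simp only [hmy, add_zero]
    rw [linkM_eq_outer hS huv hyu hyv (phiU u ρ) 1, if_neg (by rw [hu']; decide), if_pos hv', hyv',
      sum_eq_zero (fun s hs => by rw [hall' s hs]; simp)]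
    rfl
  have hk : K.profM y (phiU u ρ) = (2, 0, 0) := Prod.ext hprof.1 (Prod.ext hmid hprof.2)
  rw [K.resCell_addMark u y hyu.symm S (phiU u ρ), hu', if_pos hall', hk]
  exact payer_allZero_mark _ tb tc ta

/-- **P2⁺** (weight at `u`): for a D2 cell of `K`, the partner cell `Φ_u ρ` (all of `S` still `1`) has `K⁺ᵘ`-residual `2`. [this work] -/
theorem resCell_addMark_phiU_of_D2 (hS : ∀ w, w ∈ S ↔ (w ≠ u ∧ w ≠ v ∧ w ≠ y ∧ K.mul y w ≠ 0)) (huv : u ≠ v) (hyu : y ≠ u) (hyv : y ≠ v)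
    (hmy : K.mark y = 0) (htwo : 2 ≤ S.card) (ρ : V → Fin 3) (hu : ρ u = 0) (hv : ρ v = 1)
    (hall : ∀ s ∈ S, ρ s = 1) (hyu1 : K.mul y u = 1) (ht : (K.isolate y).ctypeM ρ = (0, 0, 1)) :
    (K.addMark u 1).resCell y S (phiU u ρ) = 2 := by
  have hu' : phiU u ρ u = 0 := by rw [phiU_self, hu]
  have hv' : phiU u ρ v = 1 := by rw [phiU_of_ne u ρ huv.symm, hv]; decide
  have huS : u ∉ S := fun h => ((hS u).1 h).1 rfl
  have hall' : ∀ s ∈ S, phiU u ρ s = 1 := fun s hs => by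
    rw [phiU_of_ne u ρ (fun h => huS (h ▸ hs)), hall s hs]; decide
  have hne : S.Nonempty := card_pos.1 (by omega)
  have hnot : ¬(∀ s ∈ S, phiU u ρ s = 0) := by
    obtain ⟨s, hs⟩ := hne; intro hh; have := hh s hs; rw [hall' s hs] at this; exact absurd this (by decide)
  obtain ⟨tb, tc, ta⟩ := ctypeM_isolate_phiU_of_001 ρ hu ht
  have hA0 : (∑ s ∈ S, (if phiU u ρ s = 0 then K.mul y s else 0)) = 0 :=
    sum_eq_zero fun s hs => by rw [hall' s hs]; simp
  have hA2 : (∑ s ∈ S, (if phiU u ρ s = 2 then K.mul y s else 0)) = 0 :=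
    sum_eq_zero fun s hs => by rw [hall' s hs]; simp
  have hge := card_le_sumS hS (phiU u ρ) 1 hall'
  have hk : K.profM y (phiU u ρ) = (1, 2, 0) := by
    unfold profM
    simp only [hmy, add_zero]
    rw [linkM_eq_outer hS huv hyu hyv (phiU u ρ) 0, linkM_eq_outer hS huv hyu hyv (phiU u ρ) 1, linkM_eq_outer hS huv hyu hyv (phiU u ρ) 2,
      if_pos hu', if_neg (by rw [hv']; decide), if_neg (by rw [hu']; decide), if_pos hv', if_neg (by rw [hu']; decide), if_neg (by rw [hv']; decide),
      hA0, hA2]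
    refine Prod.ext ?_ (Prod.ext ?_ ?_)
    · simp only [add_zero, hyu1]; rfl
    · simp only [zero_add]; exact (two_le_iff_cap3 _).1 (by omega)
    · rfl
  rw [K.resCell_addMark u y hyu.symm S (phiU u ρ), hu', if_neg hnot, sub_zero, hk]
  exact payer_allOne_mark _ tb tc ta

/-- **P5⁺** (weight at `u`): for a D5 cell of `K`, the cell `(Φ_u ρ)[s₀ ↦ 0]` has `K⁺ᵘ`-residual exactly `2` (the mark saturates the first type coordinate,
so `|S| = 2` is no exception). [this work] -/
theorem resCell_addMark_partner_of_D5 (hS : ∀ w, w ∈ S ↔ (w ≠ u ∧ w ≠ v ∧ w ≠ y ∧ K.mul y w ≠ 0)) (huv : u ≠ v) (hyu : y ≠ u) (hyv : y ≠ v)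
    (hmy : K.mark y = 0) (hyu' : K.mul y u ≠ 0) (htwo : 2 ≤ S.card) (ρ : V → Fin 3) (hu : ρ u = 0) (hv : ρ v = 1)
    {s₀ : V} (hs₀ : s₀ ∈ S) (hc₀ : ρ s₀ = 1) (hm₀ : K.mul y s₀ = 1) (hrest : ∀ s ∈ S, s ≠ s₀ → ρ s = 0) (hyv' : K.mul y v = 0)
    (ht : (K.isolate y).ctypeM ρ = (0, 0, 1)) :
    (K.addMark u 1).resCell y S (Function.update (phiU u ρ) s₀ 0) = 2 := by
  set φ := phiU u ρ with hφ
  set ρ' := Function.update φ s₀ 0 with hρ'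
  obtain ⟨hs₀u, hs₀v, hs₀y, -⟩ := (hS s₀).1 hs₀
  have huS : u ∉ S := fun h => ((hS u).1 h).1 rfl
  have hφu : φ u = 0 := by rw [hφ, phiU_self, hu]
  have hφv : φ v = 1 := by rw [hφ, phiU_of_ne u ρ huv.symm, hv]; decide
  have hφs : φ s₀ = 1 := by rw [hφ, phiU_of_ne u ρ hs₀u, hc₀]; decide
  have hφrest : ∀ s ∈ S, s ≠ s₀ → φ s = 2 := fun s hs hss => by
    rw [hφ, phiU_of_ne u ρ (fun h => huS (h ▸ hs)), hrest s hs hss]; decide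
  have hu' : ρ' u = 0 := by rw [hρ', Function.update_of_ne hs₀u.symm, hφu]
  have hv' : ρ' v = 1 := by rw [hρ', Function.update_of_ne hs₀v.symm, hφv]
  have hs' : ρ' s₀ = 0 := by rw [hρ', Function.update_self]
  have hrest' : ∀ s ∈ S, s ≠ s₀ → ρ' s = 2 := fun s hs hss => by rw [hρ', Function.update_of_ne hss, hφrest s hs hss]
  obtain ⟨tb, tc, ta⟩ := ctypeM_isolate_phiU_of_001 ρ hu ht
  rw [← hφ] at tb tc ta
  unfold ctypeM at tb tc ta
  simp only at tb tc ta
  have f1 : (K.isolate y).cntM φ 1 = 0 := (eq_zero_iff_cap3 _).2 tb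
  have f2 : (K.isolate y).cntM φ 2 = 0 := (eq_zero_iff_cap3 _).2 tc
  have f0 : (K.isolate y).cntM φ 0 ≠ 0 := fun h => ta ((eq_zero_iff_cap3 _).1 h)
  have sp0 := (K.isolate y).cntM_eq_isolate_add s₀ φ 0
  have sp1 := (K.isolate y).cntM_eq_isolate_add s₀ φ 1
  have sp2 := (K.isolate y).cntM_eq_isolate_add s₀ φ 2
  have sp0' := (K.isolate y).cntM_eq_isolate_add s₀ ρ' 0
  have sp1' := (K.isolate y).cntM_eq_isolate_add s₀ ρ' 1
  have sp2' := (K.isolate y).cntM_eq_isolate_add s₀ ρ' 2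
  rw [hφs] at sp0 sp1 sp2
  rw [hs'] at sp0' sp1' sp2'
  simp only [Fin.isValue, show ((1 : Fin 3) = 0) = False by decide, show ((1 : Fin 3) = 2) = False by decide, if_false, add_zero, if_true,
    show ((0 : Fin 3) = 1) = False by decide, show ((0 : Fin 3) = 2) = False by decide] at sp0 sp1 sp2 sp0' sp1' sp2'
  have b0 := cntM_isolate_update (K.isolate y) s₀ φ 0 0
  have b1 := cntM_isolate_update (K.isolate y) s₀ φ 0 1
  have b2 := cntM_isolate_update (K.isolate y) s₀ φ 0 2
  rw [← hρ'] at b0 b1 b2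
  have n1 : (K.isolate y).cntM ρ' 1 = 0 := by rw [sp1', b1]; omega
  have n2 : (K.isolate y).cntM ρ' 2 = 0 := by rw [sp2', b2, ← sp2, f2]
  have n0 : (K.isolate y).cntM ρ' 0 ≠ 0 := by rw [sp0', b0]; omega
  have ta' : cap3 ((K.isolate y).cntM ρ' 0) ≠ 0 := fun h => n0 ((eq_zero_iff_cap3 _).2 h)
  have htrip : (K.isolate y).ctypeM ρ' = (cap3 ((K.isolate y).cntM ρ' 0), 0, 0) := by
    unfold ctypeM; rw [(eq_zero_iff_cap3 _).1 n1, (eq_zero_iff_cap3 _).1 n2]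
  obtain ⟨s₁, hs₁, hs₁ne⟩ : ∃ s₁ ∈ S, s₁ ≠ s₀ := by
    by_contra hno; push Not at hno
    have : S.card ≤ 1 := card_le_one.2 fun a ha b hb => by rw [hno a ha, hno b hb]
    omega
  have hA0 : (∑ s ∈ S, (if ρ' s = 0 then K.mul y s else 0)) = 1 := by
    rw [sum_eq_single_of_mem s₀ hs₀ (fun s hs hss => by rw [hrest' s hs hss]; simp), if_pos hs', hm₀]
  have hA1 : (∑ s ∈ S, (if ρ' s = 1 then K.mul y s else 0)) = 0 :=
    sum_eq_zero fun s hs => by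
      by_cases hss : s = s₀
      · rw [hss, hs']; simp
      · rw [hrest' s hs hss]; simp
  have hA2 : (∑ s ∈ S, (if ρ' s = 2 then K.mul y s else 0)) ≠ 0 := by
    have := single_le_sum (f := fun s => if ρ' s = 2 then K.mul y s else 0) (fun s _ => Nat.zero_le _) hs₁
    simp only [hrest' s₁ hs₁ hs₁ne, if_true] at this
    have := Nat.one_le_iff_ne_zero.2 ((hS s₁).1 hs₁).2.2.2
    omega
  have hk : K.profM y ρ' = (2, 0, cap3 (∑ s ∈ S, (if ρ' s = 2 then K.mul y s else 0))) := by
    unfold profM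
    simp only [hmy, add_zero]
    rw [linkM_eq_outer hS huv hyu hyv ρ' 0, linkM_eq_outer hS huv hyu hyv ρ' 1, linkM_eq_outer hS huv hyu hyv ρ' 2,
      if_pos hu', if_neg (by rw [hv']; decide), if_neg (by rw [hu']; decide), if_pos hv', if_neg (by rw [hu']; decide), if_neg (by rw [hv']; decide),
      hA0, hA1, hyv']
    have hmu : 1 ≤ K.mul y u := Nat.one_le_iff_ne_zero.2 hyu'
    refine Prod.ext ?_ (Prod.ext ?_ ?_)
    · simp only; exact (two_le_iff_cap3 _).1 (by omega)
    · rfl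
    · simp only [zero_add]
  have hkc : cap3 (∑ s ∈ S, (if ρ' s = 2 then K.mul y s else 0)) ≠ 0 := fun h => hA2 ((eq_zero_iff_cap3 _).2 h)
  have hnot : ¬(∀ s ∈ S, ρ' s = 0) := fun hh => by have := hh s₁ hs₁; rw [hrest' s₁ hs₁ hs₁ne] at this; exact absurd this (by decide)
  rw [K.resCell_addMark u y hyu.symm S ρ', hu', if_neg hnot, sub_zero, hk, htrip]
  exact payer_allTwoButOne_mark _ _ rfl rfl ta' hkc

/-- **P4⁺** (weight at `v`): for a D4 cell of `K`, the sibling cell `ρ[s₀ ↦ 1]` has `K⁺ᵛ`-residual `2` (`K⁺ᵛ = K.addMark v 1`). [this work] -/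
theorem resCell_addMark_sibling_of_D4 (hS : ∀ w, w ∈ S ↔ (w ≠ u ∧ w ≠ v ∧ w ≠ y ∧ K.mul y w ≠ 0)) (huv : u ≠ v) (hyu : y ≠ u) (hyv : y ≠ v)
    (hmy : K.mark y = 0) (hyu' : K.mul y u ≠ 0) (htwo : 2 ≤ S.card) (ρ : V → Fin 3) (hu : ρ u = 0) (hv : ρ v = 1)
    {s₀ : V} (hs₀ : s₀ ∈ S) (hc₀ : ρ s₀ = 2) (hm₀ : K.mul y s₀ = 1) (hrest : ∀ s ∈ S, s ≠ s₀ → ρ s = 0) (hyv' : K.mul y v = 0)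
    (ht : (K.isolate y).ctypeM ρ = (0, 1, 0)) :
    (K.addMark v 1).resCell y S (Function.update ρ s₀ 1) = 2 := by
  set ρ' := Function.update ρ s₀ 1 with hρ'
  obtain ⟨hs₀u, hs₀v, hs₀y, -⟩ := (hS s₀).1 hs₀
  have hu' : ρ' u = 0 := by rw [hρ', Function.update_of_ne hs₀u.symm, hu]
  have hv' : ρ' v = 1 := by rw [hρ', Function.update_of_ne hs₀v.symm, hv]
  have hs' : ρ' s₀ = 1 := by rw [hρ', Function.update_self]
  have hrest' : ∀ s ∈ S, s ≠ s₀ → ρ' s = 0 := fun s hs hss => by rw [hρ', Function.update_of_ne hss, hrest s hs hss]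
  unfold ctypeM at ht
  simp only [Prod.mk.injEq] at ht
  obtain ⟨h0, h1, h2⟩ := ht
  have c0 : (K.isolate y).cntM ρ 0 = 0 := (eq_zero_iff_cap3 _).2 h0
  have c1 : (K.isolate y).cntM ρ 1 = 1 := (eq_one_iff_cap3 _).2 h1
  have c2 : (K.isolate y).cntM ρ 2 = 0 := (eq_zero_iff_cap3 _).2 h2
  have sp0 := (K.isolate y).cntM_eq_isolate_add s₀ ρ 0
  have sp1 := (K.isolate y).cntM_eq_isolate_add s₀ ρ 1
  have sp2 := (K.isolate y).cntM_eq_isolate_add s₀ ρ 2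
  have sp0' := (K.isolate y).cntM_eq_isolate_add s₀ ρ' 0
  have sp1' := (K.isolate y).cntM_eq_isolate_add s₀ ρ' 1
  have sp2' := (K.isolate y).cntM_eq_isolate_add s₀ ρ' 2
  rw [hc₀] at sp0 sp1 sp2
  rw [hs'] at sp0' sp1' sp2'
  simp only [Fin.isValue, show ((2 : Fin 3) = 0) = False by decide, show ((2 : Fin 3) = 1) = False by decide, if_false, add_zero, if_true,
    show ((1 : Fin 3) = 0) = False by decide, show ((1 : Fin 3) = 2) = False by decide] at sp0 sp1 sp2 sp0' sp1' sp2'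
  have b0 := cntM_isolate_update (K.isolate y) s₀ ρ 1 0
  have b1 := cntM_isolate_update (K.isolate y) s₀ ρ 1 1
  have b2 := cntM_isolate_update (K.isolate y) s₀ ρ 1 2
  rw [← hρ'] at b0 b1 b2
  have n0 : (K.isolate y).cntM ρ' 0 = 0 := by rw [sp0', b0, ← sp0, c0]
  have n2 : (K.isolate y).cntM ρ' 2 = 0 := by rw [sp2', b2]; omega
  have n1 : (K.isolate y).cntM ρ' 1 ≠ 0 := by rw [sp1', b1, ← sp1, c1]; omega
  have tb : cap3 ((K.isolate y).cntM ρ' 1) ≠ 0 := fun h => n1 ((eq_zero_iff_cap3 _).2 h)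
  have htrip : (K.isolate y).ctypeM ρ' = (0, cap3 ((K.isolate y).cntM ρ' 1), 0) := by
    unfold ctypeM; rw [(eq_zero_iff_cap3 _).1 n0, (eq_zero_iff_cap3 _).1 n2]
  obtain ⟨s₁, hs₁, hs₁ne⟩ : ∃ s₁ ∈ S, s₁ ≠ s₀ := by
    by_contra hno; push Not at hno
    have : S.card ≤ 1 := card_le_one.2 fun a ha b hb => by rw [hno a ha, hno b hb]
    omega
  have hA1 : (∑ s ∈ S, (if ρ' s = 1 then K.mul y s else 0)) = 1 := by
    rw [sum_eq_single_of_mem s₀ hs₀ (fun s hs hss => by rw [hrest' s hs hss]; simp), if_pos hs', hm₀]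
  have hA2 : (∑ s ∈ S, (if ρ' s = 2 then K.mul y s else 0)) = 0 :=
    sum_eq_zero fun s hs => by
      by_cases hss : s = s₀
      · rw [hss, hs']; simp
      · rw [hrest' s hs hss]; simp
  have hA0 : 1 ≤ ∑ s ∈ S, (if ρ' s = 0 then K.mul y s else 0) := by
    have := single_le_sum (f := fun s => if ρ' s = 0 then K.mul y s else 0) (fun s _ => Nat.zero_le _) hs₁
    simp only [hrest' s₁ hs₁ hs₁ne, if_true] at this
    have := Nat.one_le_iff_ne_zero.2 ((hS s₁).1 hs₁).2.2.2
    omega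
  have hk : K.profM y ρ' = (2, 1, 0) := by
    unfold profM
    simp only [hmy, add_zero]
    rw [linkM_eq_outer hS huv hyu hyv ρ' 0, linkM_eq_outer hS huv hyu hyv ρ' 1, linkM_eq_outer hS huv hyu hyv ρ' 2,
      if_pos hu', if_neg (by rw [hv']; decide), if_neg (by rw [hu']; decide), if_pos hv', if_neg (by rw [hu']; decide), if_neg (by rw [hv']; decide),
      hA1, hA2, hyv']
    have hmu : 1 ≤ K.mul y u := Nat.one_le_iff_ne_zero.2 hyu'
    refine Prod.ext ?_ (Prod.ext ?_ ?_)
    · simp only [add_zero]; exact (two_le_iff_cap3 _).1 (by omega)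
    · rfl
    · rfl
  have hnot : ¬(∀ s ∈ S, ρ' s = 0) := fun hh => by have := hh s₀ hs₀; rw [hs'] at this; exact absurd this (by decide)
  rw [K.resCell_addMark v y hyv.symm S ρ', hv', if_neg hnot, sub_zero, hk, htrip]
  exact payer_sibling_mark _ rfl rfl tb

end Payers

end MGraph

end Summit.CriticalPhenomena.PercolationContinuityZ3.Theorems.SunflowerPartition.Kempe
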